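import Literature.Barriers.CriticalPhenomena.IsingTrivialityFromDimensionFourHighDim
import Literature.Barriers.CriticalPhenomena.IsingTreeDiagramBoundGraph
import Literature.Probability.LatticeModels.CriticalGibbsUniqueness
import Literature.Probability.LatticeModels.MeanFieldBound
import HarnessLib

/-!
# High-dimensional triviality of Ising scaling limits, V: the `d ≥ 5` bound on `∑ |U₄|` for all `β ≤ β_c`

Topic `Literature/Probability/LatticeModels`; family `crit-ising` (crit-ising.S13). Proof companion of
`HighDimTrivialityMoments` (Part A): this file **discharges** the named fact

* `panis_ursellFourSum_le` — R. Panis, *Triviality of the scaling limits of critical Ising and `φ⁴`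
  models with effective dimension at least four*, Ann. Probab. 54 (2026) = arXiv:2309.05797, proof of
  Theorem 5.5, pp. 21–22 (the bounds on (1) and (2)), for the nearest-neighbour model on `ℤ^d`,
  `d ≥ 5`: there are `C, γ > 0` with
  `Σ_L⁻² ∑_{x₁,…,x₄ ∈ Λ_{rL}} |U₄^β(x₁,…,x₄)| ≤ C (β⁻⁴ ∨ β⁻²) r^γ / L^{d-4}` for all `0 < β ≤ β_c`,
  `L, r ≥ 1` and the DLR state `μ ∈ 𝒢(β, 0)` (`ursellFourSum μ L r`);

and isolates the lattice computation behind it in a form that is used again by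
`HighDimTrivialityProofs` (the tree-form route to Panis's Theorem 5.5, where the four-point Ursell
function is replaced by Aizenman's tree diagram):

* `two_mul_sum_shiftSum_pow_four_le` — for a function `S ≥ 0` on `ℤ^d`, `d ≥ 5`, with `S(0) = 1`, the
  Messager–Miracle-Solé comparison `S(z) ≤ S(w)` for `d‖w‖_∞ ≤ ‖z‖_∞` and the infrared decay
  `S(v) ≤ C₀‖v‖_∞^{2-d}`: uniformly in the volume `Λ_M`,
  `2 ∑_{u ∈ Λ_M} (∑_{a ∈ Λ_{⌊rL⌋}} S(a-u))⁴ ≤ C r^{4d} L^{4-d} · (|Λ_{m₀}| χ_{m₀})²`, `m₀ = ⌊L⌋/2d`,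
  `χ_m = ∑_{Λ_m} S` (constant depending on `d, C₀` only). This is the computation of Aizenman, CDM 2020,
  §8.1 (8.5) / Aizenman–Duminil-Copin 2021, §6.3 (bounds on (1)–(4) without the `d = 4` improvement) /
  Panis 2023, proof of Thm 5.5, exactly as carried out at `β = β_c` in
  `Literature.Barriers.CriticalPhenomena.ursellFourSum_criticalBeta_le_of_treeDiagramBound`, whose
  model-free lattice lemmas (Part A of that file) are reused verbatim;
* `twoPointFree_le_div_pow_of_le_criticalBeta` — the infrared bound in `x`-space holds uniformly in
  `0 ≤ β ≤ β_c` (the tree's bound at `β_c`, `twoPointFree_criticalBeta_upper_holds`, and Griffiths'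
  monotonicity in `β`, `twoPointFree_mono_beta` with `isingCorr_free_mono_beta_holds`);
* `isingGibbsMeasure_eq_freeState` — every `μ ∈ 𝒢(β,0)`, `0 ≤ β ≤ β_c`, `d ≥ 3`, is the translation
  invariant free state (uniqueness below and at `β_c`, both theorems of the tree, and
  `exists_freeMeasure_holds`);
* `ursellFourSum_le_of_le_criticalBeta` — `S(μ; L, r) ≤ C_d r^{4d} / L^{d-4}` for these states, from the
  finite-graph tree diagram bound `treeDiagramBound_holds` (Aizenman 1982) — whence
  `panis_ursellFourSum_le_holds` (with `γ = 4d` and the constant `C_d (β_c² + 1)`: since `β ≤ β_c`,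
  `(β_c² + 1)(β⁻⁴ ∨ β⁻²) ≥ 1`; the printed `β`-dependence `β⁻⁴ ∨ β⁻²`, which comes from the
  sliding-scale infrared bound used there for general reflection-positive interactions, is not needed
  for the nearest-neighbour model, where the infrared bound at `β_c` and Griffiths' monotonicity give a
  `β`-uniform estimate).

## References

* R. Panis, arXiv:2309.05797, Thm 5.5 and its proof, pp. 21–22 [Panis2023Triviality] (held; read).
* M. Aizenman, CDM 2020 (arXiv:2112.04248), §8.1 eq. (8.5) [AizenmanCDM2020]; M. Aizenman, Comm. Math.
  Phys. 86 (1982) [AizenmanCMP1982]; J. Fröhlich, Nucl. Phys. B 200 (1982) [FrohlichTrivialityNPB1982].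
* M. Aizenman, H. Duminil-Copin, Ann. of Math. 194 (2021) = arXiv:1912.07973, §1.3 and §6.3
  [AizenmanDuminilCopinAnnals2021].

## Design

No definition and no named fact is introduced. The barrier proof file
`IsingTrivialityFromDimensionFourHighDim` is imported for its model-free lattice-sum lemmas
(`sum_box_shiftSum_pow_four_le`, `sum_box_le_sq_of_decay`, `sum_box_le_sum_box_mul`, …), which are
theorems about a real function on `ℤ^d` and carry no barrier content.
-/

noncomputable section

open MeasureTheory Filter Finset
open scoped Topology
open Literature.Probability.LatticeModels Literature.Probability.Percolation
open Literature.Barriers.CriticalPhenomena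

namespace Literature.Probability.LatticeModels

variable {d : ℕ}

/-! ### The lattice computation, uniformly in the volume -/

/-- **The `d > 4` dimension count** (Aizenman, CDM 2020, §8.1 eq. (8.5): "`R_L(β) ≤ C L^d (χ_L)⁴/(Σ_L)²
≤ C/L^{d-4}`"; Aizenman–Duminil-Copin 2021, §6.3, bounds on (1)–(4); Panis 2023, proof of Thm 5.5,
bounds on (1)–(2), here without the sliding-scale infrared bound). Let `d ≥ 5`, `C₀ ≥ 0`. There is
`C > 0` such that for every `S ≥ 0` on `ℤ^d` with `S(0) = 1`, the Messager–Miracle-Solé comparison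
`S(z) ≤ S(w)` whenever `d‖w‖_∞ ≤ ‖z‖_∞`, and the decay `S(v) ≤ C₀ ‖v‖_∞^{-(d-2)}` (`v ≠ 0`), for all
real `L, r ≥ 1` and every volume `Λ_M`:
`2 ∑_{u ∈ Λ_M} (∑_{a ∈ Λ_{⌊rL⌋}} S(a - u))⁴ ≤ C r^{4d} L^{-(d-4)} (|Λ_{m₀}| ∑_{v ∈ Λ_{m₀}} S(v))²` with
`m₀ = ⌊L⌋/(2d)` (so that `|Λ_{m₀}| χ_{m₀} ≤ Σ_L` for a state with two-point function `S`,
`card_mul_sum_box_le_blockSpinVariance`). The proof is that of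
`ursellFourSum_criticalBeta_le_of_treeDiagramBound` (near sites through one MMS step and `χ_{3R} ≤ C₁(3R+1)²`,
far sites through two MMS factors and two infrared factors, `∑_{k>2R} |∂Λ_k| (k+1)^{-(2d-4)} ≲ R^{-(d-4)}`).
[cite: AizenmanCDM2020, §8.1 eq. (8.5)] [cite: Panis2023Triviality, proof of Thm. 5.5, bounds on (1)–(2) (pp. 21–22)] -/
theorem two_mul_sum_shiftSum_pow_four_le (hd : 5 ≤ d) {C₀ : ℝ} (hC₀ : 0 ≤ C₀) :
    ∃ C : ℝ, 0 < C ∧ ∀ (S : Site d → ℝ), (∀ v, 0 ≤ S v) → S 0 = 1 →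
      (∀ z w : Site d, d * Site.supNorm w ≤ Site.supNorm z → S z ≤ S w) →
      (∀ v : Site d, v ≠ 0 → S v ≤ C₀ / (Site.supNorm v : ℝ) ^ (d - 2)) →
      ∀ (L r : ℝ), 1 ≤ L → 1 ≤ r → ∀ M : ℕ,
        2 * ∑ u ∈ box d M, (∑ a ∈ box d ⌊r * L⌋₊, S (a - u)) ^ 4 ≤
          C * r ^ (4 * d) / L ^ (d - 4) *
            ((#(box d (⌊L⌋₊ / (2 * d))) : ℝ) * ∑ v ∈ box d (⌊L⌋₊ / (2 * d)), S v) ^ 2 := by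
  classical
  have hd2 : 2 ≤ d := by omega
  have hd1 : 1 ≤ d := by omega
  have hdR : (1 : ℝ) ≤ d := by exact_mod_cast hd1
  -- constants (depending on `d` and `C₀` only)
  set C₁ : ℝ := 1 + 2 * d * 3 ^ (d - 1) * C₀ with hC₁
  have hC₁0 : 0 ≤ C₁ := by positivity
  set Kn : ℝ := 2 * (5 : ℝ) ^ d * 4 ^ 5 * ((56 : ℝ) * d ^ 2) ^ (2 * d) *
    ((4 : ℝ) * d) ^ (2 * d) * C₁ ^ 2 with hKn
  set Kf : ℝ := 2 * (3 : ℝ) ^ (4 * d) * (C₀ * 2 ^ (d - 2)) ^ 2 * ((4 : ℝ) * d) ^ (4 * d) *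
    (2 * d * 3 ^ (d - 1)) with hKf
  have hKn0 : 0 ≤ Kn := by positivity
  have hKf0 : 0 ≤ Kf := by positivity
  refine ⟨Kn + Kf + 1, by positivity, ?_⟩
  intro S hS0 hS00 hMMS hIR L r hL hr M
  -- box sums of `S`
  set χ : ℕ → ℝ := fun m => ∑ v ∈ box d m, S v with hχ
  have hχ0 : ∀ m, 0 ≤ χ m := fun m => Finset.sum_nonneg fun v _ => hS0 v
  have hχ1 : ∀ m, 1 ≤ χ m := fun m => one_le_sum_box hS0 hS00 m
  have hχsq : ∀ m : ℕ, χ m ≤ C₁ * ((m : ℝ) + 1) ^ 2 := fun m => by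
    have h := sum_box_le_sq_of_decay (S := S) hd2 (by rw [hS00]; exact zero_le_one) hC₀ hIR m
    rw [hS00, ← hC₁] at h
    exact h
  -- integer scales `n = ⌊L⌋`, `R = ⌊rL⌋`, `m₀ = n/(2d)`, `m₁ = (m₀+1)/d`
  have hL0 : 0 ≤ L := by linarith
  have hLpos : 0 < L := by linarith
  have hLne : L ≠ 0 := hLpos.ne'
  have hdne : (d : ℝ) ≠ 0 := by positivity
  have hr0 : 0 ≤ r := by linarith
  set n : ℕ := ⌊L⌋₊ with hn
  have hn1 : 1 ≤ n := Nat.le_floor (by exact_mod_cast hL)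
  have hnL : (n : ℝ) ≤ L := Nat.floor_le hL0
  have hLn : L < n + 1 := Nat.lt_floor_add_one L
  have hL2n : L ≤ 2 * n := by
    have hn1' : (1 : ℝ) ≤ n := by exact_mod_cast hn1
    linarith
  have hrL1 : 1 ≤ r * L := one_le_mul_of_one_le_of_one_le hr hL
  have hLrL : L ≤ r * L := le_mul_of_one_le_left hL0 hr
  set R : ℕ := ⌊r * L⌋₊ with hR
  have hR1 : 1 ≤ R := Nat.le_floor (by exact_mod_cast hrL1)
  have hRrL : (R : ℝ) ≤ r * L := Nat.floor_le (by linarith)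
  have hrLR : r * L < R + 1 := Nat.lt_floor_add_one _
  have hnR : n ≤ R := Nat.floor_le_floor hLrL
  set m₀ : ℕ := n / (2 * d) with hm₀
  have hdm₀n : 2 * d * m₀ ≤ n := Nat.mul_div_le n (2 * d)
  have hm₀le : m₀ ≤ 2 * d * m₀ := Nat.le_mul_of_pos_left _ (by positivity)
  have hdm₀ : d * m₀ ≤ R + 1 := by
    calc d * m₀ ≤ 2 * (d * m₀) := Nat.le_mul_of_pos_left _ two_pos
      _ = 2 * d * m₀ := by ring
      _ ≤ n := hdm₀n
      _ ≤ R + 1 := hnR.trans (Nat.le_succ R)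
  have hm₀R : m₀ ≤ 3 * R :=
    hm₀le.trans (hdm₀n.trans (hnR.trans (Nat.le_mul_of_pos_left R (by norm_num))))
  set m₁ : ℕ := (m₀ + 1) / d with hm₁
  have hbox₀ : L / (4 * d) ≤ 2 * (m₀ : ℝ) + 1 := by
    have h1 : ((n : ℕ) : ℝ) < ((2 * d * (m₀ + 1) : ℕ) : ℝ) := by
      exact_mod_cast Nat.lt_mul_div_succ n (by positivity)
    push_cast at h1
    have hm : (0 : ℝ) ≤ m₀ := Nat.cast_nonneg m₀
    rw [div_le_iff₀ (by positivity)]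
    calc L ≤ 2 * n := hL2n
      _ ≤ 2 * (2 * d * ((m₀ : ℝ) + 1)) := by linarith
      _ = (4 * d) * ((m₀ : ℝ) + 1) := by ring
      _ ≤ (4 * d) * (2 * (m₀ : ℝ) + 1) := by gcongr; linarith
      _ = (2 * (m₀ : ℝ) + 1) * (4 * d) := by ring
  have hbox₁ : L / (8 * d ^ 2) ≤ 2 * (m₁ : ℝ) + 1 := by
    have h1 : ((m₀ + 1 : ℕ) : ℝ) < ((d * (m₁ + 1) : ℕ) : ℝ) := by
      exact_mod_cast Nat.lt_mul_div_succ (m₀ + 1) (by omega)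
    push_cast at h1
    have hm : (0 : ℝ) ≤ m₁ := Nat.cast_nonneg m₁
    have h0 : L ≤ (2 * (m₀ : ℝ) + 1) * (4 * d) := (div_le_iff₀ (by positivity)).1 hbox₀
    rw [div_le_iff₀ (by positivity)]
    calc L ≤ (2 * (m₀ : ℝ) + 1) * (4 * d) := h0
      _ ≤ (2 * ((m₀ : ℝ) + 1)) * (4 * d) := by gcongr; linarith
      _ = (8 * d) * ((m₀ : ℝ) + 1) := by ring
      _ ≤ (8 * d) * (d * ((m₁ : ℝ) + 1)) := by gcongr
      _ ≤ (8 * d) * (d * (2 * (m₁ : ℝ) + 1)) := by gcongr; linarith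
      _ = (2 * (m₁ : ℝ) + 1) * (8 * d ^ 2) := by ring
  -- cardinalities of the boxes against powers of `L`, `rL`
  have hcb₀ : (L / (4 * d)) ^ d ≤ #(box d m₀) := by
    rw [card_box]; push_cast
    exact pow_le_pow_left₀ (by positivity) hbox₀ d
  have hcb₁ : (L / (8 * d ^ 2)) ^ d ≤ #(box d m₁) := by
    rw [card_box]; push_cast
    exact pow_le_pow_left₀ (by positivity) hbox₁ d
  have hcb₀pos : 0 < (L / (4 * d)) ^ d := by positivity
  have hcb₁pos : 0 < (L / (8 * d ^ 2)) ^ d := by positivity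
  have hcbR : (#(box d R) : ℝ) ≤ (3 * (r * L)) ^ d := by
    rw [card_box]; push_cast
    exact pow_le_pow_left₀ (by positivity) (by linarith) d
  have hcb2R : (#(box d (2 * R)) : ℝ) ≤ (5 * (r * L)) ^ d := by
    rw [card_box]; push_cast
    exact pow_le_pow_left₀ (by positivity) (by linarith) d
  have hcb3R : (#(box d (3 * R)) : ℝ) ≤ (7 * (r * L)) ^ d := by
    rw [card_box]; push_cast
    exact pow_le_pow_left₀ (by positivity) (by linarith) d
  have hcm₀pos : (0 : ℝ) < #(box d m₀) := by rw [card_box]; positivity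
  have hcm₀ne : (#(box d m₀) : ℝ) ≠ 0 := hcm₀pos.ne'
  have hcm₁pos : (0 : ℝ) < #(box d m₁) := by rw [card_box]; positivity
  -- the denominator
  set D : ℝ := (#(box d m₀) : ℝ) * χ m₀ with hD
  have hχm₀pos : 0 < χ m₀ := by linarith [hχ1 m₀]
  have hD0 : 0 < D := mul_pos hcm₀pos hχm₀pos
  have hDne : D ≠ 0 := hD0.ne'
  -- the numerator
  set ρ : ℝ := (#(box d (3 * R)) : ℝ) / #(box d m₁) with hρ
  have hρ0' : 0 ≤ ρ := div_nonneg (Nat.cast_nonneg _) (Nat.cast_nonneg _)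
  set cF : ℝ := (C₀ * 2 ^ (d - 2)) ^ 2 with hcF
  have hcF0 : 0 ≤ cF := sq_nonneg _
  have hF0 : (0 : ℝ) ≤ 2 * d * 3 ^ (d - 1) / (2 * (R : ℝ) + 1) ^ (d - 4) := by positivity
  set F : ℝ := 2 * d * 3 ^ (d - 1) / (2 * (R : ℝ) + 1) ^ (d - 4) with hFdef
  have hF'0 : (0 : ℝ) ≤ 2 * d * 3 ^ (d - 1) / L ^ (d - 4) := by positivity
  set F' : ℝ := 2 * d * 3 ^ (d - 1) / L ^ (d - 4) with hF'def
  have hFF' : F ≤ F' := by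
    refine div_le_div_of_nonneg_left (by positivity) (by positivity) ?_
    exact pow_le_pow_left₀ hL0 (by linarith) _
  set Near : ℝ := #(box d (2 * R)) * χ (3 * R) ^ 4 with hNear
  set Far : ℝ := (#(box d R) : ℝ) ^ 4 * (χ m₀ / #(box d m₀)) ^ 2 * cF * F with hFar
  have hnum : ∑ u ∈ box d M, (∑ a ∈ box d R, S (a - u)) ^ 4 ≤ Near + Far :=
    sum_box_shiftSum_pow_four_le hd hS0 hMMS hC₀ hIR hdm₀ M
  -- near part
  have hρ1 : 1 + ρ ≤ 2 * ((56 : ℝ) * d ^ 2 * r) ^ d := by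
    have hρle : ρ ≤ ((56 : ℝ) * d ^ 2 * r) ^ d := by
      calc ρ ≤ (7 * (r * L)) ^ d / #(box d m₁) := div_le_div_of_nonneg_right hcb3R hcm₁pos.le
        _ ≤ (7 * (r * L)) ^ d / (L / (8 * d ^ 2)) ^ d :=
            div_le_div_of_nonneg_left (by positivity) hcb₁pos hcb₁
        _ = ((56 : ℝ) * d ^ 2 * r) ^ d := by
            rw [← div_pow]
            congr 1
            field_simp
            ring
    have hone : (1 : ℝ) ≤ ((56 : ℝ) * d ^ 2 * r) ^ d := by
      refine one_le_pow₀ ?_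
      have hdsq : (1 : ℝ) ≤ (d : ℝ) ^ 2 := one_le_pow₀ hdR
      calc (1 : ℝ) ≤ (d : ℝ) ^ 2 := hdsq
        _ ≤ (d : ℝ) ^ 2 * r := le_mul_of_one_le_right (by positivity) hr
        _ ≤ 56 * ((d : ℝ) ^ 2 * r) := le_mul_of_one_le_left (by positivity) (by norm_num)
        _ = 56 * (d : ℝ) ^ 2 * r := by ring
    linarith
  have hρ0 : 0 ≤ 1 + ρ := by linarith
  have hL2d : L ^ (2 * d) = L ^ (d + 4) * L ^ (d - 4) := by
    rw [← pow_add]; congr 1; omega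
  have hnear : 2 * Near ≤ (Kn * r ^ (3 * d + 4) / L ^ (d - 4)) * D ^ 2 := by
    have hχ3a : χ (3 * R) ≤ C₁ * (4 * (r * L)) ^ 2 := by
      refine (hχsq (3 * R)).trans ?_
      push_cast
      gcongr
      linarith
    have hχ3b : χ (3 * R) ≤ χ m₀ * (1 + ρ) := sum_box_le_sum_box_mul hS0 hMMS hd2 hm₀R
    have h4 : χ (3 * R) ^ 4 ≤ (C₁ * (4 * (r * L)) ^ 2) ^ 2 * (χ m₀ * (1 + ρ)) ^ 2 := by
      rw [show χ (3 * R) ^ 4 = χ (3 * R) ^ 2 * χ (3 * R) ^ 2 by ring]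
      exact mul_le_mul (pow_le_pow_left₀ (hχ0 _) hχ3a 2) (pow_le_pow_left₀ (hχ0 _) hχ3b 2)
        (sq_nonneg _) (sq_nonneg _)
    have haux : ((L / (4 * d)) ^ d) ^ 2 = L ^ (d + 4) * L ^ (d - 4) / ((4 : ℝ) * d) ^ (2 * d) := by
      rw [← pow_mul, div_pow, mul_comm d 2, hL2d]
    have ha0 : 0 ≤ (5 * (r * L)) ^ d := pow_nonneg (by positivity) d
    have hab0 : 0 ≤ 2 * (5 * (r * L)) ^ d * (C₁ * (4 * (r * L)) ^ 2) ^ 2 :=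
      mul_nonneg (mul_nonneg zero_le_two ha0) (sq_nonneg _)
    have hX : 2 * (5 * (r * L)) ^ d * (C₁ * (4 * (r * L)) ^ 2) ^ 2 * (1 + ρ) ^ 2 ≤
        2 * (5 * (r * L)) ^ d * (C₁ * (4 * (r * L)) ^ 2) ^ 2 *
          (2 * ((56 : ℝ) * d ^ 2 * r) ^ d) ^ 2 :=
      mul_le_mul_of_nonneg_left (pow_le_pow_left₀ hρ0 hρ1 2) hab0
    have hX0 : 0 ≤ 2 * (5 * (r * L)) ^ d * (C₁ * (4 * (r * L)) ^ 2) ^ 2 *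
        (2 * ((56 : ℝ) * d ^ 2 * r) ^ d) ^ 2 := mul_nonneg hab0 (sq_nonneg _)
    have hden₂ : ((L / (4 * d)) ^ d) ^ 2 ≤ (#(box d m₀) : ℝ) ^ 2 :=
      pow_le_pow_left₀ hcb₀pos.le hcb₀ 2
    calc 2 * Near = 2 * ((#(box d (2 * R)) : ℝ) * χ (3 * R) ^ 4) := by rw [hNear]
      _ ≤ 2 * ((5 * (r * L)) ^ d * ((C₁ * (4 * (r * L)) ^ 2) ^ 2 * (χ m₀ * (1 + ρ)) ^ 2)) :=
          mul_le_mul_of_nonneg_left (mul_le_mul hcb2R h4 (pow_nonneg (hχ0 _) 4) ha0) zero_le_two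
      _ = (2 * (5 * (r * L)) ^ d * (C₁ * (4 * (r * L)) ^ 2) ^ 2 * (1 + ρ) ^ 2 /
            (#(box d m₀) : ℝ) ^ 2) * D ^ 2 := by
          rw [hD]; field_simp
      _ ≤ (2 * (5 * (r * L)) ^ d * (C₁ * (4 * (r * L)) ^ 2) ^ 2 *
            (2 * ((56 : ℝ) * d ^ 2 * r) ^ d) ^ 2 / (#(box d m₀) : ℝ) ^ 2) * D ^ 2 :=
          mul_le_mul_of_nonneg_right (div_le_div_of_nonneg_right hX (sq_nonneg _)) (sq_nonneg _)
      _ ≤ (2 * (5 * (r * L)) ^ d * (C₁ * (4 * (r * L)) ^ 2) ^ 2 *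
            (2 * ((56 : ℝ) * d ^ 2 * r) ^ d) ^ 2 / ((L / (4 * d)) ^ d) ^ 2) * D ^ 2 :=
          mul_le_mul_of_nonneg_right (div_le_div_of_nonneg_left hX0 (pow_pos hcb₀pos 2) hden₂)
            (sq_nonneg _)
      _ = (Kn * r ^ (3 * d + 4) / L ^ (d - 4)) * D ^ 2 := by
          congr 1
          rw [haux, hKn]
          field_simp
          ring
  -- far part
  have hfar : 2 * Far ≤ (Kf * r ^ (4 * d) / L ^ (d - 4)) * D ^ 2 := by
    have haux : ((L / (4 * d)) ^ d) ^ 4 = L ^ (4 * d) / ((4 : ℝ) * d) ^ (4 * d) := by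
      rw [← pow_mul, div_pow, mul_comm d 4]
    have hq0 : 0 ≤ (χ m₀ / #(box d m₀)) ^ 2 := sq_nonneg _
    have hp0 : 0 ≤ ((3 * (r * L)) ^ d) ^ 4 := pow_nonneg (pow_nonneg (by positivity) d) 4
    have hY : (#(box d R) : ℝ) ^ 4 * (χ m₀ / #(box d m₀)) ^ 2 * cF * F ≤
        ((3 * (r * L)) ^ d) ^ 4 * (χ m₀ / #(box d m₀)) ^ 2 * cF * F' :=
      mul_le_mul (mul_le_mul_of_nonneg_right (mul_le_mul_of_nonneg_right
        (pow_le_pow_left₀ (Nat.cast_nonneg _) hcbR 4) hq0) hcF0) hFF' hF0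
        (mul_nonneg (mul_nonneg hp0 hq0) hcF0)
    have hZ0 : 0 ≤ 2 * ((3 * (r * L)) ^ d) ^ 4 * cF * F' :=
      mul_nonneg (mul_nonneg (mul_nonneg zero_le_two hp0) hcF0) hF'0
    have hden₄ : ((L / (4 * d)) ^ d) ^ 4 ≤ (#(box d m₀) : ℝ) ^ 4 :=
      pow_le_pow_left₀ hcb₀pos.le hcb₀ 4
    calc 2 * Far = 2 * ((#(box d R) : ℝ) ^ 4 * (χ m₀ / #(box d m₀)) ^ 2 * cF * F) := by rw [hFar]
      _ ≤ 2 * (((3 * (r * L)) ^ d) ^ 4 * (χ m₀ / #(box d m₀)) ^ 2 * cF * F') :=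
          mul_le_mul_of_nonneg_left hY zero_le_two
      _ = (2 * ((3 * (r * L)) ^ d) ^ 4 * cF * F' / (#(box d m₀) : ℝ) ^ 4) * D ^ 2 := by
          rw [hD]; field_simp
      _ ≤ (2 * ((3 * (r * L)) ^ d) ^ 4 * cF * F' / ((L / (4 * d)) ^ d) ^ 4) * D ^ 2 :=
          mul_le_mul_of_nonneg_right (div_le_div_of_nonneg_left hZ0 (pow_pos hcb₀pos 4) hden₄)
            (sq_nonneg _)
      _ = (Kf * r ^ (4 * d) / L ^ (d - 4)) * D ^ 2 := by
          congr 1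
          rw [haux, hKf, hcF, hF'def]
          field_simp
          ring
  -- conclusion
  have hr34 : r ^ (3 * d + 4) ≤ r ^ (4 * d) := pow_le_pow_right₀ hr (by omega)
  have hLd : 0 < L ^ (d - 4) := by positivity
  have hx0 : 0 ≤ r ^ (4 * d) := pow_nonneg hr0 _
  have hD2 : 0 ≤ D ^ 2 := sq_nonneg _
  calc 2 * ∑ u ∈ box d M, (∑ a ∈ box d R, S (a - u)) ^ 4 ≤ 2 * (Near + Far) :=
        mul_le_mul_of_nonneg_left hnum zero_le_two
    _ = 2 * Near + 2 * Far := by ring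
    _ ≤ (Kn * r ^ (3 * d + 4) / L ^ (d - 4)) * D ^ 2 + (Kf * r ^ (4 * d) / L ^ (d - 4)) * D ^ 2 :=
        add_le_add hnear hfar
    _ = ((Kn * r ^ (3 * d + 4) + Kf * r ^ (4 * d)) / L ^ (d - 4)) * D ^ 2 := by ring
    _ ≤ (((Kn + Kf + 1) * r ^ (4 * d)) / L ^ (d - 4)) * D ^ 2 := by
        refine mul_le_mul_of_nonneg_right (div_le_div_of_nonneg_right ?_ hLd.le) hD2
        calc Kn * r ^ (3 * d + 4) + Kf * r ^ (4 * d)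
            ≤ Kn * r ^ (4 * d) + Kf * r ^ (4 * d) :=
              add_le_add (mul_le_mul_of_nonneg_left hr34 hKn0) le_rfl
          _ ≤ Kn * r ^ (4 * d) + Kf * r ^ (4 * d) + r ^ (4 * d) := le_add_of_nonneg_right hx0
          _ = (Kn + Kf + 1) * r ^ (4 * d) := by ring
    _ = (Kn + Kf + 1) * r ^ (4 * d) / L ^ (d - 4) * D ^ 2 := by ring

/-! ### The free two-point function for `β ≤ β_c`: infrared bound and Messager–Miracle-Solé -/

/-- **The infrared bound in `x`-space holds uniformly up to `β_c`**: for `d ≥ 3` there is `C₀ ≥ 0`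
with `⟨σ₀σ_v⟩^∅_{β,0} ≤ C₀ / ‖v‖_∞^{d-2}` for all `0 ≤ β ≤ β_c` and `v ≠ 0` — the bound at `β_c`
(`twoPointFree_criticalBeta_upper_holds`: Fröhlich–Simon–Spencer with the Messager–Miracle-Solé
averaging, Duminil-Copin 2019, Thm. 4.8) and Griffiths' monotonicity `⟨σ₀σ_v⟩^∅_β ≤ ⟨σ₀σ_v⟩^∅_{β_c}`
(`twoPointFree_mono_beta`; this is how Panis 2023, §5, uses the standing assumption (5.1) at `β_c`
for all `β ≤ β_c`). [cite: Panis2023Triviality, §5 eq. (5.1) and proof of Thm. 5.5 (use of the infrared bound for β ≤ β_c)] [cite: DuminilCopin2019, Thm. 4.8 (upper bound)] -/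
theorem twoPointFree_le_div_pow_of_le_criticalBeta (hd : 3 ≤ d) :
    ∃ C₀ : ℝ, 0 ≤ C₀ ∧ ∀ β : ℝ, 0 ≤ β → β ≤ criticalBeta d → ∀ v : Site d, v ≠ 0 →
      twoPointFree d β v ≤ C₀ / (Site.supNorm v : ℝ) ^ (d - 2) := by
  obtain ⟨C₀, hC₀, hIR⟩ := twoPointFree_criticalBeta_le_div_pow (d := d) hd
  refine ⟨C₀, hC₀, fun β hβ hβc v hv => ?_⟩
  exact (twoPointFree_mono_beta isingCorr_free_mono_beta_holds hasBoxLimit_isingCorr_free_holds hβ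
    hβc v).trans (hIR v hv)

/-- **Structure of `𝒢(β, 0)` up to `β_c`** (Friedli–Velenik 2017, Thm. 3.28: uniqueness iff
`m*(β) = 0`; Aizenman–Duminil-Copin–Sidoravicius 2015 at `β_c`, `d ≥ 3`): for `d ≥ 3` and
`0 ≤ β ≤ β_c`, every `μ ∈ 𝒢(β, 0)` is a translation-invariant probability measure whose correlations
are the free box limits `⟨σ_A⟩^∅_{β,0}`. All inputs are theorems of the tree
(`hasUniqueGibbsMeasure_of_lt_criticalBeta_holds`, `hasUniqueGibbsMeasure_criticalBeta_holds`,
`exists_freeMeasure_holds`). [cite: FriedliVelenik2017, Thm. 3.28 and Exercise 3.16] [cite: AizenmanDuminilCopinSidoraviciusCMP2015, Thm. 1.2] -/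
theorem isingGibbsMeasure_eq_freeState (hd : 3 ≤ d) {β : ℝ} (hβ : 0 ≤ β) (hβc : β ≤ criticalBeta d)
    {μ : Measure (SpinConfig (Site d))} (hμ : μ ∈ isingGibbsMeasures d β 0) :
    IsProbabilityMeasure μ ∧ IsTranslationInvariantMeasure μ ∧
      ∀ A : Finset (Site d), spinCorr μ A = freeCorr d β 0 A := by
  classical
  obtain ⟨μf, hμf, hTI, hcorr⟩ := exists_freeMeasure_holds d 0 hβ le_rfl
  have huniq : HasUniqueGibbsMeasure (isingSpecification (zdGraph d) β 0) := by
    rcases hβc.lt_or_eq with hlt | heq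
    · exact hasUniqueGibbsMeasure_of_lt_criticalBeta_holds (by omega) hβ hlt
    · rw [heq]
      exact hasUniqueGibbsMeasure_criticalBeta_holds hd
  have hμeq : μ = μf := huniq.1 hμ hμf
  subst hμeq
  exact ⟨hμ.1, hTI, hcorr⟩

/-- The free two-point function `S = ⟨σ₀σ_·⟩^∅_{β,0}` at `0 ≤ β ≤ β_c`, `d ≥ 3`, satisfies the four
hypotheses of `two_mul_sum_shiftSum_pow_four_le`: `S ≥ 0` (Griffiths I), `S(0) = 1`, the
Messager–Miracle-Solé comparison (`twoPointFree_le_of_mul_supNorm_le`) and the infrared decay with the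
constant of `twoPointFree_le_div_pow_of_le_criticalBeta`. [cite: DuminilCopin2019, §4.3 eq. (4.10) and Thm. 4.8] -/
theorem twoPointFree_hypotheses (hd : 3 ≤ d) :
    ∃ C₀ : ℝ, 0 ≤ C₀ ∧ ∀ β : ℝ, 0 ≤ β → β ≤ criticalBeta d →
      (∀ v, 0 ≤ twoPointFree d β v) ∧ twoPointFree d β 0 = 1 ∧
      (∀ z w : Site d, d * Site.supNorm w ≤ Site.supNorm z →
        twoPointFree d β z ≤ twoPointFree d β w) ∧
      (∀ v : Site d, v ≠ 0 → twoPointFree d β v ≤ C₀ / (Site.supNorm v : ℝ) ^ (d - 2)) := by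
  obtain ⟨C₀, hC₀, hIR⟩ := twoPointFree_le_div_pow_of_le_criticalBeta (d := d) hd
  refine ⟨C₀, hC₀, fun β hβ hβc => ⟨?_, twoPointFree_zero d β, ?_, hIR β hβ hβc⟩⟩
  · have hgks : ∀ {Λ A : Finset (Site d)} {β h : ℝ} {bc : BoundaryCondition (Site d)},
        gks_one (zdGraph d) (Λ := Λ) (A := A) (β := β) (h := h) (bc := bc) :=
      GKSInequalities.gks_one_holds (zdGraph d)
    exact fun v => twoPointFree_nonneg hasBoxLimit_isingCorr_free_holds hgks hβ v
  · exact fun z w h => twoPointFree_le_of_mul_supNorm_le hβ (by omega) h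

/-! ### The `d ≥ 5` bound on `∑ |U₄|` for all `β ≤ β_c` -/

/-- **The `d > 4` bound on the normalised sum of the four-point Ursell function, for all
`β ≤ β_c`** (Panis 2023, proof of Thm 5.5, pp. 21–22; Aizenman CDM 2020, §8.1 (8.5); originally
Aizenman 1982 / Fröhlich 1982): for `d ≥ 5` there is `C > 0` such that for all `0 ≤ β ≤ β_c`, every
`μ ∈ 𝒢(β, 0)` and all real `L, r ≥ 1`,
`Σ_L⁻² ∑_{x ∈ Λ_{rL}⁴} |U₄^μ(x)| ≤ C r^{4d} / L^{d-4}` (`ursellFourSum μ L r`).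
Inputs: the finite-graph tree diagram bound (`treeDiagramBound_holds`, Aizenman 1982) passed to
the state along free boxes, `two_mul_sum_shiftSum_pow_four_le`, and `Σ_L ≥ |Λ_{m₀}| χ_{m₀}`. [cite: Panis2023Triviality, proof of Thm. 5.5, bounds on (1)–(2) (pp. 21–22)] [cite: AizenmanCDM2020, §8.1 eq. (8.5)] -/
theorem ursellFourSum_le_of_le_criticalBeta (hd : 5 ≤ d) :
    ∃ C : ℝ, 0 < C ∧ ∀ (β : ℝ), 0 ≤ β → β ≤ criticalBeta d →
      ∀ μ ∈ isingGibbsMeasures d β 0, ∀ (L r : ℝ), 1 ≤ L → 1 ≤ r →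
        ursellFourSum μ L r ≤ C * r ^ (4 * d) / L ^ (d - 4) := by
  classical
  have hd3 : 3 ≤ d := by omega
  obtain ⟨C₀, hC₀, hhyp⟩ := twoPointFree_hypotheses (d := d) hd3
  obtain ⟨C, hC, hcore⟩ := two_mul_sum_shiftSum_pow_four_le hd hC₀
  refine ⟨C, hC, fun β hβ hβc μ hμ L r hL hr => ?_⟩
  obtain ⟨hP, hTI, hcorr⟩ := isingGibbsMeasure_eq_freeState hd3 hβ hβc hμ
  haveI : IsProbabilityMeasure μ := hP
  obtain ⟨hS0, hS00, hMMS, hIR⟩ := hhyp β hβ hβc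
  have hL0 : 0 ≤ L := by linarith
  have hr0 : 0 ≤ r := by linarith
  have h2m₀ : 2 * (⌊L⌋₊ / (2 * d)) ≤ ⌊L⌋₊ := by
    calc 2 * (⌊L⌋₊ / (2 * d)) ≤ 2 * (d * (⌊L⌋₊ / (2 * d))) :=
          Nat.mul_le_mul_left 2 (Nat.le_mul_of_pos_left _ (by omega))
      _ = 2 * d * (⌊L⌋₊ / (2 * d)) := by ring
      _ ≤ ⌊L⌋₊ := Nat.mul_div_le ⌊L⌋₊ (2 * d)
  have hboxL : latticeBox d L = box d ⌊L⌋₊ := latticeBox_eq_box hL0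
  have hboxR : latticeBox d (r * L) = box d ⌊r * L⌋₊ := latticeBox_eq_box (by positivity)
  -- the two-point function of `μ` and the denominator `Σ_L ≥ |Λ_{m₀}| χ_{m₀}`
  have hS : ∀ a b, ∫ σ, spinAt a σ * spinAt b σ ∂μ = twoPointFree d β (b - a) :=
    integral_spinAt_mul_spinAt_eq_twoPointFree hTI hcorr
  obtain ⟨D, hD⟩ : ∃ D : ℝ, D = (#(box d (⌊L⌋₊ / (2 * d))) : ℝ) *
      ∑ v ∈ box d (⌊L⌋₊ / (2 * d)), twoPointFree d β v := ⟨_, rfl⟩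
  have hden : D ≤ blockSpinVariance μ L := by
    rw [hD]
    exact card_mul_sum_box_le_blockSpinVariance μ hS hS0 hboxL h2m₀
  have hD0 : 0 < D := by
    have hcm₀pos : (0 : ℝ) < #(box d (⌊L⌋₊ / (2 * d))) := by rw [card_box]; positivity
    have h1 : (1 : ℝ) ≤ ∑ v ∈ box d (⌊L⌋₊ / (2 * d)), twoPointFree d β v :=
      one_le_sum_box hS0 hS00 _
    rw [hD]
    exact mul_pos hcm₀pos (by linarith)
  -- the numerator, uniformly in the volume
  have hcoreM : ∀ M : ℕ,
      2 * ∑ u ∈ box d M, (∑ a ∈ box d ⌊r * L⌋₊, twoPointFree d β (a - u)) ^ 4 ≤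
        C * r ^ (4 * d) / L ^ (d - 4) * D ^ 2 := fun M => by
    rw [hD]
    exact hcore _ hS0 hS00 hMMS hIR L r hL hr M
  have hnum : ∑ x ∈ Fintype.piFinset (fun _ : Fin 4 => latticeBox d (r * L)),
      |connectedFour μ spinAt x| ≤ C * r ^ (4 * d) / L ^ (d - 4) * D ^ 2 := by
    rw [hboxR]
    refine sum_abs_connectedFour_le_of_forall_box hβ hcorr fun M hM => ?_
    exact (sum_abs_connectedFour_box_le_of_treeDiagramBound treeDiagramBound_holds hβ hM).trans
      (hcoreM M)
  have hx0 : 0 ≤ C * r ^ (4 * d) / L ^ (d - 4) := by positivity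
  have hnum0 : 0 ≤ C * r ^ (4 * d) / L ^ (d - 4) * D ^ 2 := mul_nonneg hx0 (sq_nonneg D)
  rw [ursellFourSum]
  calc (∑ x ∈ Fintype.piFinset (fun _ : Fin 4 => latticeBox d (r * L)), |connectedFour μ spinAt x|) /
        blockSpinVariance μ L ^ 2
      ≤ C * r ^ (4 * d) / L ^ (d - 4) * D ^ 2 / blockSpinVariance μ L ^ 2 :=
        div_le_div_of_nonneg_right hnum (sq_nonneg _)
    _ ≤ C * r ^ (4 * d) / L ^ (d - 4) * D ^ 2 / D ^ 2 :=
        div_le_div_of_nonneg_left hnum0 (pow_pos hD0 2) (pow_le_pow_left₀ hD0.le hden 2)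
    _ = C * r ^ (4 * d) / L ^ (d - 4) := by
        rw [mul_div_assoc, div_self (pow_ne_zero 2 hD0.ne'), mul_one]

/-- **Discharge of the named fact `panis_ursellFourSum_le`** (`HighDimTrivialityMoments`, Part A;
Panis 2023, proof of Thm 5.5, pp. 21–22, bounds on (1) and (2), for the nearest-neighbour model on
`ℤ^d`, `d ≥ 5`): with `γ = 4d` and `C = C_d (β_c² + 1)`, where `C_d` is the `β`-uniform constant of
`ursellFourSum_le_of_le_criticalBeta` — for `0 < β ≤ β_c` one has `1 ≤ (β_c² + 1)(β⁻⁴ ∨ β⁻²)`, so the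
uniform bound implies the printed `β`-dependent one. [cite: Panis2023Triviality, proof of Thm. 5.5, bounds on (1)–(2) (pp. 21–22)] -/
theorem panis_ursellFourSum_le_holds : panis_ursellFourSum_le := by
  intro d hd
  obtain ⟨C, hC, H⟩ := ursellFourSum_le_of_le_criticalBeta (d := d) hd
  refine ⟨C * (criticalBeta d ^ 2 + 1), 4 * d, by positivity, by positivity, ?_⟩
  intro β L r hβ hβc hL hr μ hμ
  have h := H β hβ.le hβc μ hμ L r hL hr
  have hdpos : 0 < d := by omega
  have hr0 : 0 < r := by linarith
  have hL0 : 0 < L := by linarith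
  have hrpow : r ^ ((4 * d : ℕ) : ℝ) = r ^ (4 * d) := Real.rpow_natCast r (4 * d)
  have hcast : ((4 : ℝ) * d) = ((4 * d : ℕ) : ℝ) := by push_cast; ring
  rw [hcast, hrpow]
  -- `1 ≤ (β_c² + 1) (β⁻⁴ ∨ β⁻²)` since `β² ≤ β_c² ≤ β_c² + 1`
  have hmax : 1 ≤ (criticalBeta d ^ 2 + 1) * max (β ^ (-4 : ℤ)) (β ^ (-2 : ℤ)) := by
    have h2 : β ^ (-2 : ℤ) = (β ^ 2)⁻¹ := by
      rw [zpow_neg, zpow_ofNat]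
    have hβ2 : 0 < β ^ 2 := by positivity
    have hle : β ^ 2 ≤ criticalBeta d ^ 2 + 1 := by
      have : β ^ 2 ≤ criticalBeta d ^ 2 := pow_le_pow_left₀ hβ.le hβc 2
      linarith
    calc (1 : ℝ) = β ^ 2 * (β ^ 2)⁻¹ := (mul_inv_cancel₀ hβ2.ne').symm
      _ ≤ (criticalBeta d ^ 2 + 1) * (β ^ 2)⁻¹ :=
          mul_le_mul_of_nonneg_right hle (inv_nonneg.2 hβ2.le)
      _ ≤ (criticalBeta d ^ 2 + 1) * max (β ^ (-4 : ℤ)) (β ^ (-2 : ℤ)) := by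
          rw [← h2]
          exact mul_le_mul_of_nonneg_left (le_max_right _ _) (by positivity)
  have hx : 0 ≤ C * r ^ (4 * d) / L ^ (d - 4) := by positivity
  calc ursellFourSum μ L r ≤ C * r ^ (4 * d) / L ^ (d - 4) := h
    _ = 1 * (C * r ^ (4 * d) / L ^ (d - 4)) := (one_mul _).symm
    _ ≤ ((criticalBeta d ^ 2 + 1) * max (β ^ (-4 : ℤ)) (β ^ (-2 : ℤ))) *
          (C * r ^ (4 * d) / L ^ (d - 4)) := mul_le_mul_of_nonneg_right hmax hx
    _ = C * (criticalBeta d ^ 2 + 1) * max (β ^ (-4 : ℤ)) (β ^ (-2 : ℤ)) * r ^ (4 * d) /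
          L ^ (d - 4) := by ring

end Literature.Probability.LatticeModels
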